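import Mathlib
import HarnessLib
import HarnessLib.Audit
import Summits.Langlands.Statement
import HarnessLib.Audit.Status.Attr

/-!
Route: ParahoricFibre

# Route ParahoricFibre — monodromy at v∤p from the parahoric fibres of the Iwahori patched module

It suffices to show X = ParahoricOccurrence ∧ SmallRangeGenericMonodromy. ParahoricOccurrence (the
new lever's exact
output): for K CM, π regular algebraic cuspidal on GL_n(𝔸_K), p, ι and a semisimple
Satake-compatible ρ (as in the shared
target GenericMonodromy = EisensteinMonodromy's X), in the PATCHING RANGE (p > n², p ∤ disc K, π
unramified above p, residual
image of an integral model containing SL_n(𝔽_p), a decomposed generic prime) and at a place v ∤ p in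
TAYLOR NORMAL FORM
(q_v ≡ 1 mod p, ρ|Γ_(K_v) residually trivial, unipotent on inertia), the local component π_v has a
non-zero vector fixed by the
parahoric subgroup 𝔭(W) of GL_n(K_v) attached to the Jordan type of the monodromy N of W =
WD(ρ|Γ_(K_v)) (blocks of sizes
rk N^(k-1) − rk N^k, i.e. the dual partition; Matsumoto's condition (3)).
SmallRangeGenericMonodromy: genericity of WD(ρ|Γ_(K_v))
off the patching range. With the supports OccurrenceToGeneric (Varma's ≺ + Matsumoto Prop. 2.15 +
solvable base change to
Taylor normal form: occurrence ⇒ genericity on the range) and the shared out-of-scope junction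
MonodromyToLanglands, X decides
the summit. No card is realised (nearest card parahoric-ihara-avoidance-monodromy is a different
mechanism, see Novelty).
Lean: `ParahoricOccurrence ∧ SmallRangeGenericMonodromy`

## Assembly
Pure logic (certified: Sketch2.lean rc 0; glue.lean): for each instance of GenericMonodromy, case on
the patching-range predicate
(Classical.byCases): in range, OccurrenceToGeneric applied to ParahoricOccurrence; off range,
SmallRangeGenericMonodromy; the junction
MonodromyToLanglands carries GenericMonodromy to the summit constant. Deciding theorem
`closes : ParahoricOccurrence → OccurrenceToGeneric → SmallRangeGenericMonodromy →
MonodromyToLanglands → Langlands`, every binder consumed.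

Rationale: WHY THIS LINE. Printed open question: A'Campo–Hevesi–Thorne–Whitmore (arXiv:2607.11763, Conj. 1.1.2
vs Thm 1.2.1/Cor. 1.2.2) prove local–global
compatibility for r_ι(π), π regular algebraic cuspidal over a CM field, only "forgetting the N";
Allen–Newton (AllenNewton2020 p. 1):
"it doesn't seem possible to understand the monodromy operator" by interpolation; Matsumoto
(arXiv:2312.01551 §1.2) reduces N to
finding an automorphic Π ≅ ρ with Π_v^𝔭 ≠ 0 for the parahoric 𝔭 of the dual Jordan type and calls
finding it "difficult" (he needs
potential automorphy + Harris' tensor trick, ordinary, ℓ > n²). Mechanism (imported from the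
representation theory of Iwahori–Hecke
algebras and commutative algebra of patched modules, new on this problem): at Iwahori level the
patched module M_∞ of
Calegari–Geraghty/ACC+ patching (AllenCalegariCaraianiGeeEtAl2023 §6.5, Taylor2008) is NEARLY
FAITHFUL over R_∞^(1) — full
support on EVERY component 𝒞_μ of the unipotent lifting ring — and carries a commuting action of
H(GL_n(K_v)//Iw) whose centre
acts through the universal Frobenius (semisimple compatibility, VarmaFMS2024 / torsion: ACC+ §3,
Hevesi arXiv:2606.31698); the
parahoric idempotent e_𝔭 (integral: p > n, q_v ≡ 1) splits off e_𝔭M_∞, non-zero at the μ-generic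
point of 𝒞_μ (Borel–Casselman +
Matsumoto Lemma 2.6: every irreducible with that supercuspidal support has 𝔭-invariants), hence —
support of a finite module is
specialisation-closed — non-zero at the classical point x = ρ|Γ_(K_v) ∈ 𝒞_μ (μ = type of N_x), whose
fibre is (π_v^Iw)^(⊕c) by
strong multiplicity one: so π_v^𝔭 ≠ 0, i.e. ParahoricOccurrence; Matsumoto Prop. 2.15 with Varma's ≺
gives WD(ρ|Γ_(K_v))^F-ss ≅
rec(π_v). Unlike every prior line nothing is asked of a second automorphic representation (no level
lowering — the
Calegari–Venkatesh obstruction never arises — no potential-automorphy seed, no parahoric Ihara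
avoidance, no co-Whittaker family,
no p-adic limit of N); a K₀/Brauer–Nesbitt version (Barbasch–Moy sign criterion, dimension n!/∏μ_i!
strictly monotone in dominance)
removes even the idempotent integrality. Negatives index (4 entries) untouched.

RANKED CRUXES. #0 GenericMonodromy (target) — (shared verbatim with
EisensteinMonodromy.GenericMonodromy, stmt-Langlands-10863) for every CM field K, regular algebraic
cuspidal π on GL_n(𝔸_K), prime p, ι and every SEMISIMPLE ρ : Γ_K → GL_n(ℚ̄_p) with the
Satake-predicted arithmetic-Frobenius characteristic polynomials at cofinitely many places,
WD(ρ|Γ_(K_v)) is GENERIC at every finite v ∤ p (no non-zero WD-map to its ‖·‖-twist). All n, all p.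
(why it might fail: all p is demanded: outside the patching range (residually reducible, p ≤ n², p |
disc K) no mechanism exists; a reducible r_ι(π) with inter-constituent monodromy makes the
semisimple ρ's N too small while (A) survives.) [VarmaFMS2024, AllenNewton2020, arXiv:2312.01551,
arXiv:2607.11763, HarrisLanTaylorThorneRMS2016]
#2 ParahoricOccurrence (crux) — PARAHORIC OCCURRENCE at a Taylor place in the patching range: K CM,
π regular algebraic cuspidal on GL_n(𝔸_K), p > n², p ∤ disc K, π unramified above p, ρ semisimple
Satake-compatible with an integral model g·ρ·g⁻¹ whose reduction contains SL_n(𝔽_p) and a decomposed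
generic prime l; v ∤ p with q_v ≡ 1 (mod p), g·ρ|Γ_(K_v)·g⁻¹ ≡ 1 mod 𝔪 and ρ(I_v) unipotent; then
for every W = WD(ρ|Γ_(K_v)) (Grothendieck–Deligne) the local component π_v has a non-zero vector
fixed by the parahoric 𝔭(W) = integral g₁ with unit determinant and (i,j)-entry in 𝔭_v whenever
blk(j) < blk(i), blk(i) = #(t ∈ [1,n] : n − rk N^t ≤ i) (blocks = dual Jordan partition of N; N = 0
gives GL_n(𝒪_v), N regular gives Iw). Proof plan = the lever (idempotent e_𝔭 on the nearly faithful
Iwahori patched module; skeleton bc/ParahoricOccurrence_birth.lean: SupportSpecialisation +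
IwahoriDatum ⇒ crux, proved). [difficulty: L] (why it might fail: In defect l₀>0 the H_Iw-action on
patched TOP-degree cohomology must commute with 𝕋_∞ exactly enough that the classical fibre is
(π_v^Iw)^c and the centre acts via Frobenius at non-classical generic points; Tor/boundary terms or
nilpotent fuzz in R→𝕋/I could break either identification.) [Taylor2008,
AllenCalegariCaraianiGeeEtAl2023, arXiv:2312.01551, VarmaFMS2024, arXiv:2606.31698,
ClozelHarrisTaylor2008, Zelevinsky1980]
#4 SmallRangeGenericMonodromy (crux) — genericity of WD(ρ|Γ_(K_v)) (the X-clause) for all (K, π, p,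
ι, ρ, v ∤ p) OUTSIDE the patching range: p ≤ n², or p | disc K, or π ramified above p, or no
integral model with residual image ⊇ SL_n(𝔽_p), or no decomposed generic prime. Plan: p-adic side —
same lever with Kisin-type / ordinary local conditions at p and the K₀-version (no idempotent
integrality); residual side — small-image patching (Thorne2012, Allen–Newton–Thorne) where
available; the rest is open (skeleton bc/SmallRangeGenericMonodromy_birth.lean: PadicSide +
ResidualSide ⇒ crux, proved). [deps: ParahoricOccurrence] [difficulty: open-problem] (why it might
fail: Residually reducible non-ordinary ρ over CM has no patching datum at all
(ResiduallyReducibleBarrier); no λ-independence mechanism for N inside the compatible system is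
known, so the exceptional (π, ι) may stay out of reach of every lever.) [Thorne2012,
AllenNewton2020, arXiv:2312.01551, CaraianiNewton2023,
Literature.Barriers.Langlands.ResiduallyReducibleBarrier]
#9 OccurrenceToGeneric (support) — ParahoricOccurrence ⇒ genericity on the whole patching range (any
v ∤ p): (a) solvable CM base change K′/K disjoint from K(ρ̄), unramified above p, putting w | v in
Taylor normal form (CHT-type Grunwald–Wang lemma; Arthur–Clozel base change of π, cuspidal by large
image; Satake compatibility upstairs; genericity descends since Hom over W_(K_v) ⊂ Hom over
W_(K′_w)); (b) Varma's dominance WD(ρ|Γ_w)^F-ss ≺ rec(BC(π)_w) and weak temperedness (Clozel purity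
+ Shalika, Matsumoto Prop. 2.19); (c) Matsumoto Prop. 2.15 (3)⇒(1): 𝔭(W)-invariants + ≺ ⇒ WD ≅ rec,
which is generic (Jacquet–Shalika). Known results + bookkeeping; vendor (b), (c) as Literature
facts. [difficulty: L] [VarmaFMS2024, arXiv:2312.01551, ClozelHarrisTaylor2008, Allen2016,
arXiv:2607.11763]
#9 MonodromyToLanglands (support) — OUT-OF-SCOPE REMAINDER, shared verbatim with
EisensteinMonodromy.MonodromyToLanglands (stmt-Langlands-10829): GenericMonodromy → Langlands —
everything this thesis does not claim (𝓡 for every number field, direction (B), (A) outside the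
CM/regular/v∤ℓ monodromy clause, translation of genericity into `LocalGlobalCompatibleAt` via Varma
+ GenericWDUnique + the L/C twist). Declared, NOT claimed; not to be staffed from this route.
[difficulty: open-problem] [BuzzardGeeLMS2014, VarmaFMS2024, Allen2016]

TWO-LAYER PLAN. ParahoricOccurrence ⇐ SupportSpecialisation (pure algebra, provable now) →
IwahoriDatum (existence of the Hecke-equivariant nearly
faithful Iwahori patching datum with parahoric idempotent, typed distillation in
bc/ParahoricOccurrence_birth.lean) → ParahoricOccurrence
(proved composition). SmallRangeGenericMonodromy ⇐ PadicSide → ResidualSide (proved case split).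
Filed as registered skeleton stubs, not items.

KILL CRITERIA. A referee-checked failure of the lever in the defect-zero toy (definite unitary
group, n = 2, Steinberg place, where every input —
Taylor2008 nearly-faithfulness, Harris–Taylor semisimple compatibility, Borel–Casselman — is a
theorem) names a broken step and closes
the route `refuted:ParahoricOccurrence` with that step as a barrier note (Hecke-equivariant
patching). A counterexample to GenericMonodromy
itself (spectacular) refutes the summit clause. EisensteinMonodromy or a Matsumoto-type theorem
proving GenericMonodromy for all p moots it
(`superseded`).

NOT DECOMPOSED YET. The torsion semisimple compatibility of the Bernstein centre at Iwahori level
inside ACC+ patching (exact form needed: centre ≡ Frobenius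
mod the nilpotent ideal), the Tor/top-degree bookkeeping identifying the classical fibre, the
K₀/Brauer–Nesbitt variant for p ≤ n, the
v | p analogue (potentially semistable rings: PatchingLocalComponent bites, deliberately NOT
claimed), and the residual-side coverage —
layer-2 children or prover-side `--supports` lemmas.

CHEAPEST FALSIFIER. Run the lever by hand in defect zero: G definite unitary over F⁺ split at v, Π
with Π_v = St₂, p ≥ 5, q_v ≡ 1 (p), r̄ trivial at v:
check (i) H(G(F_v⁺)//Iw) acts on S_1(U_Q,𝒪)_𝔪 compatibly with Taylor's patching, (ii) its centre
acts via the R_v^(1)-Frobenius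
(HT semisimple compatibility), (iii) M_∞^(1) nearly faithful (Taylor2008 Thm), (iv) fibre at x =
(St^Iw)^c; if all four hold the
argument reproves Taylor–Yoshida at Iwahori places in two pages — a literature/expert lookup ("is
this folklore? is (i)–(iv) flawed?")
is the cheapest kill. Searched: arXiv/lit for "monodromy Iwahori Hecke patched module", Allen–Newton
1901.05490 §1, Matsumoto
2312.01551 §1.2–§2 (read): no such argument in print; both go through potential automorphy instead.

NUMBERS. Known sectors of GenericMonodromy: n = 2 weight 0 density-one ℓ (AllenNewton2020 Thm 1.1);
n = 2 all weights positive-density ℓ and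
all n, ℓ > n², ι-ordinary under residual conditions (arXiv:2312.01551 Thms 1.1, 1.3, 1.5);
polarizable: all (TY07, Caraiani). Range
constants in the crux: p > n² (ACC+/Matsumoto numerology), [GL_n(𝒪_v):Iw] ≡ n! mod p (idempotent
integrality needs p > n). Items at
open: 5.

DEFINITION REQUESTS. None blocking (all five items typed over existing declarations). Wanted later
as Literature facts: Varma's dominance theorem in WD
vocabulary (VarmaFMS2024 Thm 2), Matsumoto Prop. 2.15 / Lemma 2.6 (parahoric invariants vs Jordan
type), and a notion
`IwahoriHeckeAlgebra (GL (Fin n) K_v)` with its centre for typing the datum natively.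

Novelty: Searches (2026-08-17): `lit search --source arxiv` ×4 ("local-global compatibility monodromy
operator Iwahori Hecke algebra patching" 0;
"monodromy rank two Galois representations CM fields Allen Newton" 1 = 1901.05490; "Ihara avoidance
monodromy operator local-global
compatibility" 0; "patched module Iwahori level generic representation Whittaker local-global
compatibility l not p" 0);
`lit frontier Langlands --since 2025` (80 rows; relevant 2607.11763, 2603.19768, 2605.03519,
2302.07789); `lit read` arXiv:2607.11763
pp. 1–8, 111–113, arXiv:1901.05490 pp. 1–4, arXiv:2312.01551 pp. 2–18, arXiv:2603.19768 pp. 3–4,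
Calegari 2109.14145 §9.6/§10/§12;
131 idea cards + 60 open routes read (ideas_all.json, open_routes.json).
Nearest prior art found: arXiv:2312.01551 (Matsumoto: same endgame Prop. 2.15, but needs an
automorphic seed with the SAME monodromy
type via potential automorphy + Harris tensor trick; ordinary, ℓ > n²); AllenNewton2020 / Luu 2015
(level exclusion with a
level-lowered seed); card parahoric-ihara-avoidance-monodromy (variant of Allen–Newton: parahoric
Ihara avoidance + level-controlled
potential automorphy); route EisensteinMonodromy (co-Whittaker family at the Siegel–Eisenstein
point).
Delta: the parahoric information is extracted from the SAME Iwahori-level patched module by Hecke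
idempotents and the
specialisation-closedness of supports, so Taylor's existing nearly-faithfulness replaces every seed
/ level-lowering / family input.
Claimed grade: new-mechanism  [refs: 2607.11763, 1901.05490, 2312.01551, 2603.19768, AllenNewton2020]

Barriers (technique_class: patching, hecke-idempotents, iwahori-hecke-modules): - technique_class: patching, hecke-idempotents, iwahori-hecke-modules
- Literature.Barriers.Langlands.MonodromyNotClosedUnderPadicLimits: evaded — no statement of the
form "limit of N of type ν" is used; N enters only through the parahoric invariants of π_v
(automorphic side, exact) and the support geometry of the patched module over the unipotent lifting
ring.
- Literature.Barriers.Langlands.PatchingLocalComponentBarrier: at v ∤ p the component problem is the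
INPUT (Taylor's Ihara avoidance = full support on all components of R_v^(1)); at v ∣ p it bites and
the v ∣ p clause is deliberately not claimed (target is v ∤ p).
- Literature.Barriers.Langlands.ResiduallyReducibleBarrier: it bites on SmallRangeGenericMonodromy
(no patching datum for residually reducible non-ordinary ρ); the bet is confined to the named crux.
- Literature.Barriers.Langlands.TaylorWilesNumericalCoincidence: evaded by consuming positive-defect
Calegari–Geraghty/ACC+ patching as a black box (nearly-faithfulness is their theorem), not
re-deriving it.
- Literature.Barriers.Langlands.TaylorWilesNumericalCoincidenceNarrow: not met — the route proves no
automorphy of a Galois representation; patching is used only through the SUPPORT of the patched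
module at an already automorphic point (direction automorphic → Galois, LGC), and in positive defect
via ACC+ rather than defect-zero numerics.
- Literature.Barriers.Langlands.NonRegularWeightBarrier: not engaged — π is regular algebraic
throughout; the target is the

History (route lifecycle, newest last):
- 2026-08-24T04:16:45Z · DORMANT — reconciler: no traction for 6.5 d (last activity item-evidence-added at 2026-08-17T15:00:53Z); parked, not closed — `ledger route dormant route-Langlands-Paraho (operator:999:564875)
- 2026-08-29T10:33:55Z · REACTIVATED — reconciler: reactivated — activity statement-checked at 2026-08-29T09:41:20Z after parking at 2026-08-24T04:16:45Z (operator:999:2677693)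

sub-problem: Langlands · status: open · opened planner-plan-novel-Langlands-Langlands-e266a39d-a-v2-g26-0 2026-08-17T13:39:49Z · rev 1 · ledger route-Langlands-ParahoricFibre
GENERATED by the gate from the ledger (D-0016/17). Provers cite these decls: `theorem foo : Summit.Langlands.Langlands.Theses.ParahoricFibre.<Decl> := …` in Summits/Langlands/Langlands/Theorems/<Name>.lean.
-/

namespace Summit.Langlands.Langlands.Theses.ParahoricFibre

open scoped BigOperators Topology Manifold Classical MeasureTheory ProbabilityTheory Matrix InnerProductSpace ComplexConjugate ContinuousMap
open Filter Set Function TopologicalSpace MeasureTheory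

attribute [summit_statement] _root_.Langlands

/-- item stmt-Langlands-10863 · target · rank 0 · open · by planner
why it might fail: all p is demanded: outside the patching range (residually reducible, p ≤ n², p | disc K) no mechanism exists; a reducible r_ι(π) with inter-constituent monodromy makes the semisimple ρ's N too small while (A) survives.
sources: VarmaFMS2024, AllenNewton2020, arXiv:2312.01551, arXiv:2607.11763, HarrisLanTaylorThorneRMS2016
[target] X — for every CM field K, regular algebraic cuspidal π on GL_n(𝔸_K), prime p, ι : ℚ̄_p ≃ ℂ
and every SEMISIMPLE ρ : Γ_K → GL_n(ℚ̄_p) whose arithmetic-Frobenius characteristic polynomials are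
arithFrobPolyOfSatake ι q_v n α for the Satake parameter α of π_v at all but finitely many v (rev 2:
this cofinite Satake–Frobenius clause replaces `HarrisLanTaylorThorne2016.IsCompatible π.1 ι ρ` —
formally a wider class of ρ, the same class ρ ≅ r_(p,ι)(π) by Chebotarev + Brauer–Nesbitt in tree,
`FramedGaloisRep.nonempty_equiv_of_hasFrobCharpolyAt_eventually`, once HLTT's r exists — so that the
route imports nothing beyond the Statement), the Weil–Deligne representation of ρ|Γ_(K_v)
(Grothendieck–Deligne recipe `IsWeilDeligneOfLadic`) at every finite v ∤ p is GENERIC (Allen2016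
Def. 1.1.2: no non-zero WD-map to its ‖·‖-twist). All n, all p. -/
@[route_item "route-Langlands-ParahoricFibre"]
def GenericMonodromy : Prop :=
  ∀ (K : Type) [Field K] [NumberField K], NumberField.IsCMField K → ∀ (n : ℕ) (hcpt : Literature.NumberTheory.Automorphic.isCompact_glFiniteIntegralLevel n K) (π : Literature.NumberTheory.Automorphic.CuspidalAutomorphicRepData n K hcpt), π.1.IsRegularAlgebraic → ∀ (p : ℕ) [Fact p.Prime] (ι : PadicAlgCl p ≃+* ℂ) (ρ : Literature.NumberTheory.GaloisRepresentations.FramedGaloisRep K (PadicAlgCl p) n), ρ.toGaloisRep.IsSemisimple → (∀ᶠ v : IsDedekindDomain.HeightOneSpectrum (NumberField.RingOfIntegers K) in Filter.cofinite, ∀ α : Multiset ℂ, π.1.HasSatakeParamAt v α → ρ.IsUnramifiedAt v ∧ ρ.HasFrobCharpolyAt v (Literature.NumberTheory.Automorphic.arithFrobPolyOfSatake ι v.residueCard n α)) → ∀ v : IsDedekindDomain.HeightOneSpectrum (NumberField.RingOfIntegers K), ((p : ℕ) : NumberField.RingOfIntegers K) ∉ v.asIdeal → ∃ W : Literature.NumberTheory.GaloisRepresentations.WeilDeligneRep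 (v.adicCompletion K) (PadicAlgCl p) (Fin n → PadicAlgCl p), Literature.NumberTheory.GaloisRepresentations.IsWeilDeligneOfLadic (ρ.toLocal v).toWeilGroupHom W ∧ ∀ f : (Fin n → PadicAlgCl p) →ₗ[PadicAlgCl p] (Fin n → PadicAlgCl p), (∀ w : Literature.NumberTheory.GaloisRepresentations.WeilGroup (v.adicCompletion K), f ∘ₗ W.ρ w = ((Literature.NumberTheory.GaloisRepresentations.IsNonarchimedeanLocalField.residueFieldCard (v.adicCompletion K) : PadicAlgCl p) ^ (Literature.NumberTheory.GaloisRepresentations.WeilGroup.deg w)) • (W.ρ w ∘ₗ f)) → f ∘ₗ W.N = W.N ∘ₗ f → f = 0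

/-- item stmt-Langlands-18194 · crux · rank 2 · open
reduced to route-Langlands-OrdinaryLocusCarving: OrdinaryParahoricOccurrence, NonOrdinaryParahoricOccurrence · residual NonOrdinaryParahoricOccurrence
refined by: route-Langlands-OrdinaryLocusCarving [split, draft] · by planner
why it might fail: In defect l₀>0 the H_Iw-action on patched TOP-degree cohomology must commute with 𝕋_∞ exactly enough that the classical fibre is (π_v^Iw)^c and the centre acts via Frobenius at non-classical generic points; Tor/boundary terms or nilpotent fuzz in R→𝕋/I could break either identification.
sources: Taylor2008, AllenCalegariCaraianiGeeEtAl2023, arXiv:2312.01551, VarmaFMS2024, arXiv:2606.31698, ClozelHarrisTaylor2008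
[crux] PARAHORIC OCCURRENCE at a Taylor place in the patching range: K CM, π regular algebraic
cuspidal on GL_n(𝔸_K), p > n², p ∤ disc K, π unramified above p, ρ semisimple Satake-compatible with
an integral model g·ρ·g⁻¹ whose reduction contains SL_n(𝔽_p) and a decomposed generic prime l; v ∤ p
with q_v ≡ 1 (mod p), g·ρ|Γ_(K_v)·g⁻¹ ≡ 1 mod 𝔪 and ρ(I_v) unipotent; then for every W =
WD(ρ|Γ_(K_v)) (Grothendieck–Deligne) the local component π_v has a non-zero vector fixed by the
parahoric 𝔭(W) = integral g₁ with unit determinant and (i,j)-entry in 𝔭_v whenever blk(j) < blk(i),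
blk(i) = #(t ∈ [1,n] : n − rk N^t ≤ i) (blocks = dual Jordan partition of N; N = 0 gives GL_n(𝒪_v),
N regular gives Iw). Proof plan = the lever (idempotent e_𝔭 on the nearly faithful Iwahori patched
module; skeleton bc/ParahoricOccurrence_birth.lean: SupportSpecialisation + IwahoriDatum ⇒ crux,
proved). [difficulty: L] -/
@[route_item "route-Langlands-ParahoricFibre", crux]
def ParahoricOccurrence : Prop :=
  open IsDedekindDomain NumberField Polynomial Filter Literature.NumberTheory.Automorphic Literature.NumberTheory.GaloisRepresentations in ∀ (K : Type) [Field K] [NumberField K], NumberField.IsCMField K → ∀ (n : ℕ) (hcpt : isCompact_glFiniteIntegralLevel n K) (π : CuspidalAutomorphicRepData n K hcpt), π.1.IsRegularAlgebraic → ∀ (p : ℕ) [Fact p.Prime] (ι : PadicAlgCl p ≃+* ℂ) (ρ : FramedGaloisRep K (PadicAlgCl p) n), ρ.toGaloisRep.IsSemisimple → (∀ᶠ v : HeightOneSpectrum (𝓞 K) in cofinite, ∀ α : Multiset ℂ, π.1.HasSatakeParamAt v α → ρ.IsUnramifiedAt v ∧ ρ.HasFrobCharpolyAt v (arithFrobPolyOfSatake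 ι v.residueCard n α)) → n ^ 2 < p → ¬ ((p : ℤ) ∣ NumberField.discr K) → (∀ w : HeightOneSpectrum (𝓞 K), ((p : ℕ) : 𝓞 K) ∈ w.asIdeal → π.1.IsUnramifiedAt w) → ∀ g : GL (Fin n) (PadicAlgCl p), (∀ (σ : Field.absoluteGaloisGroup K) (i j : Fin n), ‖((g * ρ σ * g⁻¹ : GL (Fin n) (PadicAlgCl p)) : Matrix (Fin n) (Fin n) (PadicAlgCl p)) i j‖ ≤ 1) → (∀ M : Matrix (Fin n) (Fin n) ℤ, M.det = 1 → ∃ σ : Field.absoluteGaloisGroup K, ∀ i j : Fin n, ‖((g * ρ σ * g⁻¹ : GL (Fin n) (PadicAlgCl p)) : Matrix (Fin n) (Fin n) (PadicAlgCl p)) i j - ((M i j : ℤ) : PadicAlgCl p)‖ < 1) → (∃ l : ℕ, l.Prime ∧ l ≠ p ∧ ∀ w : HeightOneSpectrum (𝓞 K), ((l : ℕ) : 𝓞 K) ∈ w.asIdeal → w.residueCard = l ∧ ρ.IsUnramifiedAt w ∧ ∃ a : Fin n → PadicAlgCl p, ρ.HasFrobCharpolyAt w (∏ i, (X - C (a i)))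 ∧ ∀ i j : Fin n, i ≠ j → ‖a i - a j‖ = 1 ∧ ‖a i - (l : PadicAlgCl p) * a j‖ = 1) → ∀ v : HeightOneSpectrum (𝓞 K), ((p : ℕ) : 𝓞 K) ∉ v.asIdeal → p ∣ (v.residueCard - 1) → (∀ (σ : Field.absoluteGaloisGroup (v.adicCompletion K)) (i j : Fin n), ‖((g * ρ.toLocal v σ * g⁻¹ : GL (Fin n) (PadicAlgCl p)) : Matrix (Fin n) (Fin n) (PadicAlgCl p)) i j - (1 : Matrix (Fin n) (Fin n) (PadicAlgCl p)) i j‖ < 1) → (∀ σ ∈ absInertia (v.adicCompletion K), (((ρ.toLocal v σ : GL (Fin n) (PadicAlgCl p)) : Matrix (Fin n) (Fin n) (PadicAlgCl p)) - 1) ^ n = 0) → ∀ W : WeilDeligneRep (v.adicCompletion K) (PadicAlgCl p) (Fin n → PadicAlgCl p), IsWeilDeligneOfLadic (ρ.toLocal v).toWeilGroupHom W → ∃ πv : SmoothIrrep (GL (Fin n) (v.adicCompletion K)), π.1.HasLocalComponentAt v πv.ρ ∧ ∃ x : πv.V, x ≠ 0 ∧ ∀ g₁ : GL (Fin n) (v.adicCompletion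 K), (∀ i j : Fin n, Valued.v ((g₁ : Matrix (Fin n) (Fin n) (v.adicCompletion K)) i j) ≤ 1) → Valued.v (g₁ : Matrix (Fin n) (Fin n) (v.adicCompletion K)).det = 1 → (∀ i j : Fin n, (Finset.univ.filter fun t : Fin n => n ≤ j.val + Module.finrank (PadicAlgCl p) (LinearMap.range (W.N ^ (t.val + 1)))).card < (Finset.univ.filter fun t : Fin n => n ≤ i.val + Module.finrank (PadicAlgCl p) (LinearMap.range (W.N ^ (t.val + 1)))).card → Valued.v ((g₁ : Matrix (Fin n) (Fin n) (v.adicCompletion K)) i j) < 1) → πv.ρ g₁ x = x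

/-- item stmt-Langlands-18195 · crux · rank 4 · open
reduced to route-Langlands-MonodromyRankLadder: ConductorRung, DepthRungs · residual DepthRungs
refined by: route-Langlands-MonodromyRankLadder [split, draft]; route-Langlands-SmallRangeOrdinaryCarving [split, draft] · by planner
why it might fail: Residually reducible non-ordinary ρ over CM has no patching datum at all (ResiduallyReducibleBarrier); no λ-independence mechanism for N inside the compatible system is known, so the exceptional (π, ι) may stay out of reach of every lever.
sources: Thorne2012, AllenNewton2020, arXiv:2312.01551, CaraianiNewton2023, Literature.Barriers.Langlands.ResiduallyReducibleBarrier
[crux] genericity of WD(ρ|Γ_(K_v)) (the X-clause) for all (K, π, p, ι, ρ, v ∤ p) OUTSIDE the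
patching range: p ≤ n², or p | disc K, or π ramified above p, or no integral model with residual
image ⊇ SL_n(𝔽_p), or no decomposed generic prime. Plan: p-adic side — same lever with Kisin-type /
ordinary local conditions at p and the K₀-version (no idempotent integrality); residual side —
small-image patching (Thorne2012, Allen–Newton–Thorne) where available; the rest is open (skeleton
bc/SmallRangeGenericMonodromy_birth.lean: PadicSide + ResidualSide ⇒ crux, proved). [deps:
ParahoricOccurrence] [difficulty: open-problem] -/
@[route_item "route-Langlands-ParahoricFibre", crux]
def SmallRangeGenericMonodromy : Prop :=
  open IsDedekindDomain NumberField Polynomial Filter Literature.NumberTheory.Automorphic Literature.NumberTheory.GaloisRepresentations in ∀ (K : Type) [Field K] [NumberField K], NumberField.IsCMField K → ∀ (n : ℕ) (hcpt : isCompact_glFiniteIntegralLevel n K) (π : CuspidalAutomorphicRepData n K hcpt), π.1.IsRegularAlgebraic → ∀ (p : ℕ) [Fact p.Prime] (ι : PadicAlgCl p ≃+* ℂ) (ρ : FramedGaloisRep K (PadicAlgCl p) n), ρ.toGaloisRep.IsSemisimple → (∀ᶠ v : HeightOneSpectrum (𝓞 K) in cofinite, ∀ α : Multiset ℂ, π.1.HasSatakeParamAt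 v α → ρ.IsUnramifiedAt v ∧ ρ.HasFrobCharpolyAt v (arithFrobPolyOfSatake ι v.residueCard n α)) → ¬ (n ^ 2 < p ∧ ¬ ((p : ℤ) ∣ NumberField.discr K) ∧ (∀ w : HeightOneSpectrum (𝓞 K), ((p : ℕ) : 𝓞 K) ∈ w.asIdeal → π.1.IsUnramifiedAt w) ∧ (∃ g : GL (Fin n) (PadicAlgCl p), (∀ (σ : Field.absoluteGaloisGroup K) (i j : Fin n), ‖((g * ρ σ * g⁻¹ : GL (Fin n) (PadicAlgCl p)) : Matrix (Fin n) (Fin n) (PadicAlgCl p)) i j‖ ≤ 1) ∧ (∀ M : Matrix (Fin n) (Fin n) ℤ, M.det = 1 → ∃ σ : Field.absoluteGaloisGroup K, ∀ i j : Fin n, ‖((g * ρ σ * g⁻¹ : GL (Fin n) (PadicAlgCl p)) : Matrix (Fin n) (Fin n) (PadicAlgCl p)) i j - ((M i j : ℤ) : PadicAlgCl p)‖ < 1)) ∧ (∃ l : ℕ, l.Prime ∧ l ≠ p ∧ ∀ w : HeightOneSpectrum (𝓞 K), ((l : ℕ) : 𝓞 K) ∈ w.asIdeal → w.residueCard = l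 ∧ ρ.IsUnramifiedAt w ∧ ∃ a : Fin n → PadicAlgCl p, ρ.HasFrobCharpolyAt w (∏ i, (X - C (a i))) ∧ ∀ i j : Fin n, i ≠ j → ‖a i - a j‖ = 1 ∧ ‖a i - (l : PadicAlgCl p) * a j‖ = 1)) → ∀ v : HeightOneSpectrum (𝓞 K), ((p : ℕ) : 𝓞 K) ∉ v.asIdeal → ∃ W : WeilDeligneRep (v.adicCompletion K) (PadicAlgCl p) (Fin n → PadicAlgCl p), IsWeilDeligneOfLadic (ρ.toLocal v).toWeilGroupHom W ∧ ∀ f : (Fin n → PadicAlgCl p) →ₗ[PadicAlgCl p] (Fin n → PadicAlgCl p), (∀ w : WeilGroup (v.adicCompletion K), f ∘ₗ W.ρ w = ((IsNonarchimedeanLocalField.residueFieldCard (v.adicCompletion K) : PadicAlgCl p) ^ (WeilGroup.deg w)) • (W.ρ w ∘ₗ f)) → f ∘ₗ W.N = W.N ∘ₗ f → f = 0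

/-- item stmt-Langlands-10829 · support · rank 9 · open · by planner
sources: BuzzardGeeLMS2014, VarmaFMS2024, Allen2016
[support] OUT-OF-SCOPE REMAINDER (route-repair rbadge-Langlands-EisensteinMonodromy-ebd2e64e-g4;
D-0027 §2.1 layer invariant), filed only so that the route's deciding theorem `closes` can honestly
end at the summit constant: GenericMonodromy → Langlands. It contains everything this thesis does
NOT claim — the reciprocity data 𝓡 for every number field (LocalLanglandsDatum.nonempty,
PstWeilDeligneData.nonempty), direction (B), direction (A) for non-CM F / merely L-algebraic
(irregular) π / v ∣ ℓ / irreducibility and de Rham above ℓ, and the translation of X into the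
literal `LocalGlobalCompatibleAt` clause at v ∤ ℓ (Varma's semisimple compatibility VarmaFMS2024 Thm
1 as a WD-vocabulary fact + GenericWDUnique + "rec of a generic π_v is generic", Allen2016 §1.1, and
the C↔L twist |det|^((1−n)/2)) — i.e. the rest of GL_n reciprocity (same pattern as
DegenerateLimits.LanglandsOfTarget, TriangulineChamber.SliceToLanglands,
CapacityClassicality.SectorToLanglands). Declared, NOT claimed; not to be staffed from this route;
dischargeable only as the conjunction of other routes. -/
@[route_item "route-Langlands-ParahoricFibre", crux]
def MonodromyToLanglands : Prop :=
  GenericMonodromy → _root_.Langlands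

/-- item stmt-Langlands-18196 · support · rank 9 · open · by planner
sources: VarmaFMS2024, arXiv:2312.01551, ClozelHarrisTaylor2008, Allen2016, arXiv:2607.11763
[support] ParahoricOccurrence ⇒ genericity on the whole patching range (any v ∤ p): (a) solvable CM
base change K′/K disjoint from K(ρ̄), unramified above p, putting w | v in Taylor normal form
(CHT-type Grunwald–Wang lemma; Arthur–Clozel base change of π, cuspidal by large image; Satake
compatibility upstairs; genericity descends since Hom over W_(K_v) ⊂ Hom over W_(K′_w)); (b) Varma's
dominance WD(ρ|Γ_w)^F-ss ≺ rec(BC(π)_w) and weak temperedness (Clozel purity + Shalika, Matsumoto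
Prop. 2.19); (c) Matsumoto Prop. 2.15 (3)⇒(1): 𝔭(W)-invariants + ≺ ⇒ WD ≅ rec, which is generic
(Jacquet–Shalika). Known results + bookkeeping; vendor (b), (c) as Literature facts. [difficulty: L] -/
@[route_item "route-Langlands-ParahoricFibre", crux]
def OccurrenceToGeneric : Prop :=
  open IsDedekindDomain NumberField Polynomial Filter Literature.NumberTheory.Automorphic Literature.NumberTheory.GaloisRepresentations in ParahoricOccurrence → ∀ (K : Type) [Field K] [NumberField K], NumberField.IsCMField K → ∀ (n : ℕ) (hcpt : isCompact_glFiniteIntegralLevel n K) (π : CuspidalAutomorphicRepData n K hcpt), π.1.IsRegularAlgebraic → ∀ (p : ℕ) [Fact p.Prime] (ι : PadicAlgCl p ≃+* ℂ) (ρ : FramedGaloisRep K (PadicAlgCl p) n), ρ.toGaloisRep.IsSemisimple → (∀ᶠ v : HeightOneSpectrum (𝓞 K) in cofinite, ∀ α : Multiset ℂ, π.1.HasSatakeParamAt v α → ρ.IsUnramifiedAt v ∧ ρ.HasFrobCharpolyAt v (arithFrobPolyOfSatake ι v.residueCard n α)) → (n ^ 2 < p ∧ ¬ ((p : ℤ)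 ∣ NumberField.discr K) ∧ (∀ w : HeightOneSpectrum (𝓞 K), ((p : ℕ) : 𝓞 K) ∈ w.asIdeal → π.1.IsUnramifiedAt w) ∧ (∃ g : GL (Fin n) (PadicAlgCl p), (∀ (σ : Field.absoluteGaloisGroup K) (i j : Fin n), ‖((g * ρ σ * g⁻¹ : GL (Fin n) (PadicAlgCl p)) : Matrix (Fin n) (Fin n) (PadicAlgCl p)) i j‖ ≤ 1) ∧ (∀ M : Matrix (Fin n) (Fin n) ℤ, M.det = 1 → ∃ σ : Field.absoluteGaloisGroup K, ∀ i j : Fin n, ‖((g * ρ σ * g⁻¹ : GL (Fin n) (PadicAlgCl p)) : Matrix (Fin n) (Fin n) (PadicAlgCl p)) i j - ((M i j : ℤ) : PadicAlgCl p)‖ < 1)) ∧ (∃ l : ℕ, l.Prime ∧ l ≠ p ∧ ∀ w : HeightOneSpectrum (𝓞 K), ((l : ℕ) : 𝓞 K) ∈ w.asIdeal → w.residueCard = l ∧ ρ.IsUnramifiedAt w ∧ ∃ a : Fin n → PadicAlgCl p, ρ.HasFrobCharpolyAt w (∏ i, (X - C (a i))) ∧ ∀ i j : Fin n, i ≠ j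 → ‖a i - a j‖ = 1 ∧ ‖a i - (l : PadicAlgCl p) * a j‖ = 1)) → ∀ v : HeightOneSpectrum (𝓞 K), ((p : ℕ) : 𝓞 K) ∉ v.asIdeal → ∃ W : WeilDeligneRep (v.adicCompletion K) (PadicAlgCl p) (Fin n → PadicAlgCl p), IsWeilDeligneOfLadic (ρ.toLocal v).toWeilGroupHom W ∧ ∀ f : (Fin n → PadicAlgCl p) →ₗ[PadicAlgCl p] (Fin n → PadicAlgCl p), (∀ w : WeilGroup (v.adicCompletion K), f ∘ₗ W.ρ w = ((IsNonarchimedeanLocalField.residueFieldCard (v.adicCompletion K) : PadicAlgCl p) ^ (WeilGroup.deg w)) • (W.ρ w ∘ₗ f)) → f ∘ₗ W.N = W.N ∘ₗ f → f = 0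

/-- item stmt-Langlands-18197 · assembly · rank 1 · closed · proved by Summit.Langlands.Langlands.Theorems.ParahoricFibreAssembly.assembly_proof (prover) · by planner
sources: VarmaFMS2024, arXiv:2312.01551
[assembly] ParahoricOccurrence → OccurrenceToGeneric → SmallRangeGenericMonodromy →
MonodromyToLanglands → Langlands (provable now: the Classical.byCases bookkeeping of Sketch2.lean;
`closes` applies it to the four items). -/
@[route_item "route-Langlands-ParahoricFibre", crux]
def Assembly : Prop :=
  ParahoricOccurrence → OccurrenceToGeneric → SmallRangeGenericMonodromy → MonodromyToLanglands → _root_.Langlands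

-- `Assembly` holds: proved by `Summit.Langlands.Langlands.Theorems.ParahoricFibreAssembly.assembly_proof` (its module imports this route file, so no `_holds` link can be stated here).

/-! D-0027 §2.1 — DECIDING THEOREM (planner-authored via `route open/edit --closes-file`; by planner-plan-novel-Langlands-Langlands-e266a39d-a-v2-g26-0 2026-08-17T13:39:49Z):
its hypotheses are this route's items and its conclusion the sub-problem Statement (glue_lint), and it elaborates with this file. -/

@[closes "route-Langlands-ParahoricFibre"] theorem closes (hOcc : ParahoricOccurrence) (hOG : OccurrenceToGeneric)
    (hSmall : SmallRangeGenericMonodromy) (hJ : MonodromyToLanglands) (hA : Assembly) : _root_.Langlands :=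
  hA hOcc hOG hSmall hJ

end Summit.Langlands.Langlands.Theses.ParahoricFibre
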